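import Literature.NumberTheory.EllipticCurves.EisensteinSeriesTwoCharacterWeightTwoQExpansion
import Literature.NumberTheory.EllipticCurves.EisensteinSeriesTwoCharacterBernoulli
import Literature.NumberTheory.EllipticCurves.EisensteinSeriesWeightTwoCharacter
import HarnessLib

/-!
# Constant terms of `S_2^{ψ,φ}` at all cusps, Bernoulli normalisation, `p`-integrality

Topic `Literature/NumberTheory/EllipticCurves`; namespace
`Literature.NumberTheory.EllipticCurves.ModularForms`.  THEOREMS and one definition with body
(`twoCharTwoUnit`); no named fact.

For the weight-`2` combination `S = S_2^{ψ,φ}` of `℘`-division values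
(`EisensteinSeriesTwoCharacterWeightTwo`, `ψ ≠ 1` modulo `u`, `φ` modulo `v`,
`ψ(-1)φ(-1) = 1`) we compute the constant `twoCharTwoCusp ψ φ γ` of `S ∣₂ γ` at `i∞` for EVERY
`γ = (a b; c d) ∈ SL₂(ℤ)`:

* `twoCharTwoCusp_of_not_dvd` — it vanishes unless `v ∣ c`;
* `twoCharTwoCusp_of_eq_mul` — for `c = vc'` it is `2 (uv)² L(2, ψφ̄) ψ(-c') φ(d)` (the map
  `(c₁, d₀) ↦ x = (vc₁, d₀)γ` is a bijection and `x₀ = 0 ⟺ (vc₁, d₀) = (0, x₁)γ⁻¹ = (-x₁c, x₁a)`;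
  the level-one constants `-2ζ(2)` cancel since `∑ ψ(c₁) = 0`; then
  `∑_{x₁ mod uv} (ψφ̄)(x₁) ∑_n (x̃₁ - uvn)^{-2} = 2 L(2, ψφ̄)` by `sum_inv_mul_tsum_inv_sq`);
* `inv_twoCharTwoConst_mul_twoCharTwoCusp` — dividing by the coefficient constant
  `twoCharTwoConst = 2u²(-2πi)² W(φ̄)` and inserting `L(2, Λ) = -(2πi)² B_{2,Λ̄}/(4 uv W(Λ̄))`
  (`Λ = ψφ̄` primitive modulo `uv`): the normalised form `S/twoCharTwoConst` (coefficients
  `σ_1^{ψ,φ}(n)`, `a₀ = 0`) has constant term `[v ∣ c] · e₂ · ψ(-c/v) φ(d)` with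
  `e₂ = twoCharTwoUnit ψ φ = -v B_{2,Λ̄} / (4u W(Λ̄) W(φ̄))`;
* `valuation_twoCharTwoUnit_eq_one` — `e₂` is a `p`-adic unit when `B_{2,Λ̄}/2` is and
  `p ∤ 2uv`; `valuation_qExpansion_coeff_twoCharTwoMF_le` — `v(aₙ(S)) ≤ v(twoCharTwoConst)`.

## References

* F. Diamond, J. Shurman, *A First Course in Modular Forms*, GTM 228 (2005), §4.6 (Thm. 4.6.2),
  §4.8. [DiamondShurman2005]
* T. M. Apostol, *Introduction to Analytic Number Theory* (1976), Thm. 12.19. [Apostol1976]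
-/

noncomputable section

open UpperHalfPlane EisensteinSeries Complex Filter Finset DirichletCharacter Matrix
  Literature.NumberTheory.LFunctions

open scoped Real MatrixGroups

namespace Literature.NumberTheory.EllipticCurves.ModularForms

section Cusps

variable {u v : ℕ} [NeZero u] [NeZero v] (ψ : DirichletCharacter ℂ u) (φ : DirichletCharacter ℂ v)

/-- `a d ≡ 1 (mod L)` for `γ = (a b; c d) ∈ Γ₀(L)`, so `χ̄(a) = χ(d)`. [folklore] -/
theorem inv_apply00_eq_apply11 {L : ℕ} (χ : DirichletCharacter ℂ L) {γ : SL(2, ℤ)}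
    (hγ : γ ∈ CongruenceSubgroup.Gamma0 L) : χ⁻¹ ((γ 0 0 : ℤ) : ZMod L) = χ ((γ 1 1 : ℤ) : ZMod L) := by
  have hdet := Matrix.SpecialLinearGroup.det_coe γ
  rw [Matrix.det_fin_two] at hdet
  have hc : ((γ 1 0 : ℤ) : ZMod L) = 0 := CongruenceSubgroup.Gamma0_mem.mp hγ
  have h := congrArg (fun x : ℤ ↦ (x : ZMod L)) hdet
  simp only [Int.cast_sub, Int.cast_mul, Int.cast_one, hc, mul_zero, sub_zero] at h
  have h1 : χ ((γ 0 0 : ℤ) : ZMod L) * χ ((γ 1 1 : ℤ) : ZMod L) = 1 := by rw [← map_mul, h, map_one]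
  rw [MulChar.inv_apply_eq_inv']
  exact inv_eq_of_mul_eq_one_right h1

/-- The periodic constant `H(t) = ∑_{n ∈ ℤ} (t̃ - Nn)^{-2}` of a residue `t mod N`. [folklore] -/
def hurwitzTwo (N : ℕ) (t : ZMod N) : ℂ := ∑' n : ℤ, (((t.val - N * n : ℤ) : ℂ) ^ 2)⁻¹

/-- `K_a = [a₀ = 0] N² H(a₁) - 2ζ(2)` for `a ∈ (ℤ/N)²`. [cite: DiamondShurman2005, §4.6] -/
theorem pdivConstZ_eq (N : ℕ) [NeZero N] (a : Fin 2 → ZMod N) :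
    pdivConstZ N a = (if a 0 = 0 then (N : ℂ) ^ 2 * hurwitzTwo N (a 1) else 0) - 2 * riemannZeta 2 := by
  rw [pdivConstZ, weierstrassPDivConst, hurwitzTwo]
  congr 1
  have : ((N : ℤ) ∣ ((a 0).val : ℤ)) ↔ a 0 = 0 := by
    rw [← ZMod.intCast_zmod_eq_zero_iff_dvd, Int.cast_natCast, ZMod.natCast_zmod_val]
  by_cases h : a 0 = 0
  · rw [if_pos (this.mpr h), if_pos h]
  · rw [if_neg (fun h' ↦ h (this.mp h')), if_neg h]

omit [NeZero u] [NeZero v] in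
/-- The first entry of `(vc₁, d₀)γ`. [folklore] -/
theorem tcVec_vecMul_zero (c₁ : ZMod u) (d₀ : ZMod (u * v)) (γ : SL(2, ℤ)) :
    ((tcVec c₁ d₀ ᵥ* γ : Fin 2 → ZMod (u * v))) 0 =
      vMul c₁ * ((γ 0 0 : ℤ) : ZMod (u * v)) + d₀ * ((γ 1 0 : ℤ) : ZMod (u * v)) := by
  simp [tcVec, Matrix.vecMul, dotProduct, Fin.sum_univ_two]

omit [NeZero u] [NeZero v] in
/-- The second entry of `(vc₁, d₀)γ`. [folklore] -/
theorem tcVec_vecMul_one (c₁ : ZMod u) (d₀ : ZMod (u * v)) (γ : SL(2, ℤ)) :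
    ((tcVec c₁ d₀ ᵥ* γ : Fin 2 → ZMod (u * v))) 1 =
      vMul c₁ * ((γ 0 1 : ℤ) : ZMod (u * v)) + d₀ * ((γ 1 1 : ℤ) : ZMod (u * v)) := by
  simp [tcVec, Matrix.vecMul, dotProduct, Fin.sum_univ_two]

/-- The constant with the level-one part removed. [folklore] -/
theorem twoCharTwoCusp_eq_sum_main (hψ1 : ψ ≠ 1) (γ : SL(2, ℤ)) :
    twoCharTwoCusp ψ φ γ = ∑ c₁ : ZMod u, ∑ d₀ : ZMod (u * v), tcWeight ψ φ c₁ d₀ *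
      (if ((tcVec c₁ d₀ ᵥ* γ : Fin 2 → ZMod (u * v))) 0 = 0 then
        ((u * v : ℕ) : ℂ) ^ 2 *
          hurwitzTwo (u * v) (((tcVec c₁ d₀ ᵥ* γ : Fin 2 → ZMod (u * v))) 1)
        else 0) := by
  haveI : NeZero (u * v) := ⟨mul_ne_zero (NeZero.ne u) (NeZero.ne v)⟩
  unfold twoCharTwoCusp
  simp_rw [pdivConstZ_eq, mul_sub, Finset.sum_sub_distrib]
  rw [sub_eq_self]
  simp_rw [← Finset.sum_mul, sum_tcWeight_eq_zero ψ φ hψ1, zero_mul]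

/-- **`v ∤ c`: the constant term of `S ∣₂ γ` vanishes** (a term with `x₀ = 0` has `d₀ c ≡ 0 (mod v)`
with `c` not `≡ 0`, so `d₀` is a non-unit modulo `v` and `φ̄(d₀) = 0`). [cite: DiamondShurman2005, §4.6] -/
theorem twoCharTwoCusp_of_not_dvd (hψ1 : ψ ≠ 1) {γ : SL(2, ℤ)} (h : ¬ (v : ℤ) ∣ γ 1 0) :
    twoCharTwoCusp ψ φ γ = 0 := by
  rw [twoCharTwoCusp_eq_sum_main ψ φ hψ1]
  refine Finset.sum_eq_zero fun c₁ _ ↦ Finset.sum_eq_zero fun d₀ _ ↦ ?_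
  split_ifs with h0
  · -- `φ̄(d₀) = 0`
    have hv : ZMod.castHom (dvd_mul_left v u) (ZMod v) d₀ * ((γ 1 0 : ℤ) : ZMod v) = 0 := by
      have := congrArg (ZMod.castHom (dvd_mul_left v u) (ZMod v)) h0
      rwa [tcVec_vecMul_zero, map_add, map_mul, map_mul, castHom_vMul, zero_mul, zero_add,
        map_intCast, map_zero] at this
    have hnu : ¬ IsUnit (ZMod.castHom (dvd_mul_left v u) (ZMod v) d₀) := fun hu ↦ h <| by
      rw [← ZMod.intCast_zmod_eq_zero_iff_dvd]
      exact (hu.mul_right_eq_zero).mp hv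
    rw [tcWeight, MulChar.map_nonunit _ hnu, mul_zero, zero_mul]
  · rw [mul_zero]

/-- The parametrisation `x₁ ↦ (c₁, d₀) = (-x₁ c' mod u, x₁ a)` of the index pairs with `x₀ = 0`
(`c = vc'`). [folklore] -/
def cuspParam (γ : SL(2, ℤ)) (c' : ℤ) (x₁ : ZMod (u * v)) : ZMod u × ZMod (u * v) :=
  (-(ZMod.castHom (dvd_mul_right u v) (ZMod u) x₁ * ((c' : ℤ) : ZMod u)),
    x₁ * ((γ 0 0 : ℤ) : ZMod (u * v)))

/-- The reduction `ℤ/uv → ℤ/u` through representatives. [folklore] -/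
theorem castHom_eq_intCast_val (x₁ : ZMod (u * v)) :
    ZMod.castHom (dvd_mul_right u v) (ZMod u) x₁ = ((x₁.val : ℤ) : ZMod u) := by
  haveI : NeZero (u * v) := ⟨mul_ne_zero (NeZero.ne u) (NeZero.ne v)⟩
  conv_lhs => rw [← ZMod.natCast_zmod_val x₁]
  rw [map_natCast, Int.cast_natCast]

/-- `v · (first component of the parametrisation) = -x₁ c` in `ℤ/uv`. [folklore] -/
theorem vMul_cuspParam_fst {γ : SL(2, ℤ)} {c' : ℤ} (hc : (γ 1 0 : ℤ) = v * c') (x₁ : ZMod (u * v)) :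
    vMul (cuspParam γ c' x₁).1 = -(x₁ * ((γ 1 0 : ℤ) : ZMod (u * v))) := by
  haveI : NeZero (u * v) := ⟨mul_ne_zero (NeZero.ne u) (NeZero.ne v)⟩
  rw [cuspParam]
  dsimp only
  rw [castHom_eq_intCast_val, ← Int.cast_mul, ← Int.cast_neg, vMul_intCast, hc]
  conv_rhs => rw [← ZMod.natCast_zmod_val x₁]
  push_cast
  ring

/-- **`c = vc'`: the constant term of `S ∣₂ γ` is `2 (uv)² L(2, ψφ̄) ψ(-c') φ(d)`.**
[cite: DiamondShurman2005, §4.6 (Thm. 4.6.2)] -/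
theorem twoCharTwoCusp_of_eq_mul (hψ1 : ψ ≠ 1) (hpar : ψ (-1) * φ (-1) = 1) {γ : SL(2, ℤ)}
    (c' : ℤ) (hc : (γ 1 0 : ℤ) = v * c') :
    twoCharTwoCusp ψ φ γ = 2 * ((u * v : ℕ) : ℂ) ^ 2 *
      (changeLevel (dvd_mul_right u v) ψ * changeLevel (dvd_mul_left v u) φ⁻¹).LFunction 2 *
        ψ ((-c' : ℤ) : ZMod u) * φ ((γ 1 1 : ℤ) : ZMod v) := by
  haveI : NeZero (u * v) := ⟨mul_ne_zero (NeZero.ne u) (NeZero.ne v)⟩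
  set Λ := changeLevel (dvd_mul_right u v) ψ * changeLevel (dvd_mul_left v u) φ⁻¹ with hΛ
  have hdet : (γ 0 0 : ℤ) * γ 1 1 - γ 0 1 * γ 1 0 = 1 := by
    have := Matrix.SpecialLinearGroup.det_coe γ
    rwa [Matrix.det_fin_two] at this
  have hdetZ : ((γ 0 0 : ℤ) : ZMod (u * v)) * ((γ 1 1 : ℤ) : ZMod (u * v)) -
      ((γ 0 1 : ℤ) : ZMod (u * v)) * ((γ 1 0 : ℤ) : ZMod (u * v)) = 1 := by
    have := congrArg ((↑) : ℤ → ZMod (u * v)) hdet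
    push_cast at this
    exact this
  rw [twoCharTwoCusp_eq_sum_main ψ φ hψ1, ← Finset.sum_product']
  -- the summand as a function of the pair
  set F : ZMod u × ZMod (u * v) → ℂ := fun q ↦ tcWeight ψ φ q.1 q.2 *
    (if ((tcVec q.1 q.2 ᵥ* γ : Fin 2 → ZMod (u * v))) 0 = 0 then
      ((u * v : ℕ) : ℂ) ^ 2 *
        hurwitzTwo (u * v) (((tcVec q.1 q.2 ᵥ* γ : Fin 2 → ZMod (u * v))) 1)
      else 0) with hF
  change ∑ q ∈ (Finset.univ : Finset (ZMod u)) ×ˢ (Finset.univ : Finset (ZMod (u * v))), F q = _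
  rw [Finset.univ_product_univ]
  -- restrict to the image of the parametrisation
  have hinj : Function.Injective (cuspParam (u := u) (v := v) γ c') := by
    intro x y hxy
    have h1 := congrArg (fun q : ZMod u × ZMod (u * v) ↦ vMul (v := v) q.1) hxy
    have h2 := congrArg Prod.snd hxy
    simp only [vMul_cuspParam_fst hc] at h1
    simp only [cuspParam] at h2
    -- `x = x (ad - bc) = d (x a) - b (x c)`
    have : ∀ z : ZMod (u * v), z = ((γ 1 1 : ℤ) : ZMod (u * v)) * (z * ((γ 0 0 : ℤ) : ZMod (u * v))) +
        ((γ 0 1 : ℤ) : ZMod (u * v)) * (-(z * ((γ 1 0 : ℤ) : ZMod (u * v)))) := fun z ↦ by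
      linear_combination -z * hdetZ
    rw [this x, this y, h1, h2]
  have hzero : ∀ q : ZMod u × ZMod (u * v),
      ((tcVec q.1 q.2 ᵥ* γ : Fin 2 → ZMod (u * v))) 0 = 0 →
        q = cuspParam γ c' (((tcVec q.1 q.2 ᵥ* γ : Fin 2 → ZMod (u * v))) 1) := by
    rintro ⟨c₁, d₀⟩ h0
    rw [tcVec_vecMul_zero] at h0
    have hd₀ : d₀ = ((tcVec c₁ d₀ ᵥ* γ : Fin 2 → ZMod (u * v))) 1 *
        ((γ 0 0 : ℤ) : ZMod (u * v)) := by
      rw [tcVec_vecMul_one]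
      linear_combination -d₀ * hdetZ - ((γ 0 1 : ℤ) : ZMod (u * v)) * h0
    have hc₁ : vMul c₁ = -(((tcVec c₁ d₀ ᵥ* γ : Fin 2 → ZMod (u * v))) 1 *
        ((γ 1 0 : ℤ) : ZMod (u * v))) := by
      rw [tcVec_vecMul_one]
      linear_combination (-(vMul c₁)) * hdetZ + ((γ 1 1 : ℤ) : ZMod (u * v)) * h0
    refine Prod.ext ?_ ?_
    · apply vMul_injective (u := u) (v := v)
      rw [hc₁, vMul_cuspParam_fst hc]
    · simpa [cuspParam] using hd₀
  have hparam0 : ∀ x₁ : ZMod (u * v),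
      ((tcVec (cuspParam γ c' x₁).1 (cuspParam γ c' x₁).2 ᵥ* γ : Fin 2 → ZMod (u * v))) 0 = 0 := by
    intro x₁
    rw [tcVec_vecMul_zero, vMul_cuspParam_fst hc]
    simp only [cuspParam]
    ring
  have hparam1 : ∀ x₁ : ZMod (u * v),
      ((tcVec (cuspParam γ c' x₁).1 (cuspParam γ c' x₁).2 ᵥ* γ : Fin 2 → ZMod (u * v))) 1 = x₁ := by
    intro x₁
    rw [tcVec_vecMul_one, vMul_cuspParam_fst hc]
    simp only [cuspParam]
    linear_combination x₁ * hdetZ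
  have hsupp : ∀ q ∈ (Finset.univ : Finset (ZMod u × ZMod (u * v))),
      q ∉ Finset.univ.image (cuspParam γ c') → F q = 0 := by
    intro q _ hq
    simp only [hF]
    rw [if_neg, mul_zero]
    intro h0
    exact hq (Finset.mem_image.mpr ⟨_, Finset.mem_univ _, (hzero q h0).symm⟩)
  rw [← Finset.sum_subset (Finset.subset_univ _) hsupp, Finset.sum_image fun x _ y _ h ↦ hinj h]
  simp only [hF, hparam0, hparam1, if_true]
  -- the weights along the parametrisation: `ψ(-c') φ̄(a) Λ(x₁)`
  have hu1 : u ≠ 1 := fun h ↦ by subst h; exact hψ1 (level_one ψ)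
  have hweight : ∀ x₁ : ZMod (u * v), tcWeight ψ φ (cuspParam γ c' x₁).1 (cuspParam γ c' x₁).2 =
      ψ ((-c' : ℤ) : ZMod u) * φ⁻¹ ((γ 0 0 : ℤ) : ZMod v) * Λ x₁ := by
    intro x₁
    have hΛx : Λ x₁ = ψ (x₁.val : ZMod u) * φ⁻¹ (x₁.val : ZMod v) := by
      rw [hΛ]
      conv_lhs => rw [← ZMod.natCast_zmod_val x₁]
      exact changeLevel_mul_changeLevel_inv_apply_natCast ψ φ x₁.val
    have h2 : ZMod.castHom (dvd_mul_left v u) (ZMod v) x₁ = (x₁.val : ZMod v) := by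
      conv_lhs => rw [← ZMod.natCast_zmod_val x₁]
      rw [map_natCast]
    rw [tcWeight, cuspParam]
    dsimp only
    rw [neg_mul_eq_mul_neg, map_mul, castHom_eq_intCast_val, Int.cast_natCast, ← Int.cast_neg,
      map_mul, map_intCast (ZMod.castHom (dvd_mul_left v u) (ZMod v)), h2, map_mul, hΛx]
    ring
  simp_rw [hweight]
  -- `∑ Λ(x₁) H(x₁) = 2 L(2, Λ)`
  have hΛeven : Λ⁻¹ (-1) = 1 := by
    rw [inv_apply_neg_one, hΛ, changeLevel_mul_changeLevel_inv_apply_neg_one, hpar]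
  have hsum := sum_inv_mul_tsum_inv_sq Λ⁻¹ hΛeven UpperHalfPlane.I
  rw [inv_inv] at hsum
  have hsum' : ∑ x₁ : ZMod (u * v), Λ x₁ * hurwitzTwo (u * v) x₁ = 2 * Λ.LFunction 2 := by
    rw [← hsum]
    rfl
  have hφa : φ⁻¹ ((γ 0 0 : ℤ) : ZMod v) = φ ((γ 1 1 : ℤ) : ZMod v) := by
    have hγv : γ ∈ CongruenceSubgroup.Gamma0 v := by
      rw [CongruenceSubgroup.Gamma0_mem, hc]; push_cast; rw [ZMod.natCast_self, zero_mul]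
    exact inv_apply00_eq_apply11 φ hγv
  calc ∑ x : ZMod (u * v), ψ ((-c' : ℤ) : ZMod u) * φ⁻¹ ((γ 0 0 : ℤ) : ZMod v) * Λ x *
        (((u * v : ℕ) : ℂ) ^ 2 * hurwitzTwo (u * v) x)
      = ψ ((-c' : ℤ) : ZMod u) * φ⁻¹ ((γ 0 0 : ℤ) : ZMod v) * ((u * v : ℕ) : ℂ) ^ 2 *
          ∑ x : ZMod (u * v), Λ x * hurwitzTwo (u * v) x := by
        rw [Finset.mul_sum]; refine Finset.sum_congr rfl fun x _ ↦ ?_; ring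
    _ = _ := by rw [hsum', hφa]; ring

end Cusps

/-! ### Bernoulli normalisation and `p`-integrality -/

section Normalised

variable {u v : ℕ} [NeZero u] [NeZero v] (ψ : DirichletCharacter ℂ u) (φ : DirichletCharacter ℂ v)

/-- **The cusp unit `e₂ = -v B_{2,Λ̄} / (4 u W(Λ̄) W(φ̄))`**, `Λ = ψφ̄ (mod uv)`: the constant term of
the normalised form `S_2^{ψ,φ}/twoCharTwoConst` at a cusp with `v ∣ c` is `e₂ ψ(-c/v) φ(d)`.
[cite: DiamondShurman2005, Thm. 4.6.2] -/
def twoCharTwoUnit : ℂ :=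
  (-(v : ℂ) * generalizedBernoulli 2
      (changeLevel (dvd_mul_right u v) ψ * changeLevel (dvd_mul_left v u) φ⁻¹)⁻¹) /
    (4 * u * gaussSum (changeLevel (dvd_mul_right u v) ψ * changeLevel (dvd_mul_left v u) φ⁻¹)⁻¹
        (ZMod.stdAddChar (N := u * v)) * gaussSum φ⁻¹ (ZMod.stdAddChar (N := v)))

/-- `twoCharTwoConst ≠ 0` (`φ` primitive). [folklore] -/
theorem twoCharTwoConst_ne_zero (hφ : φ.IsPrimitive) : twoCharTwoConst u φ ≠ 0 := by
  have hW := gaussSum_ne_zero φ⁻¹ (Literature.NumberTheory.LFunctions.isPrimitive_inv φ hφ)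
  have hu0 : (u : ℂ) ≠ 0 := by exact_mod_cast NeZero.ne u
  have hv0 : (v : ℂ) ≠ 0 := by exact_mod_cast NeZero.ne v
  have hπ : (-2 * Real.pi * Complex.I : ℂ) ≠ 0 :=
    mul_ne_zero (mul_ne_zero (by norm_num) (by exact_mod_cast Real.pi_ne_zero)) I_ne_zero
  rw [twoCharTwoConst]
  push_cast
  exact mul_ne_zero (pow_ne_zero _ (mul_ne_zero hu0 hv0)) (mul_ne_zero two_ne_zero
    (mul_ne_zero (mul_ne_zero (inv_ne_zero (pow_ne_zero _ hv0)) (pow_ne_zero _ hπ)) hW))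

/-- **Normalised constant terms, `v ∤ c`**: zero. [cite: DiamondShurman2005, Thm. 4.6.2] -/
theorem inv_twoCharTwoConst_mul_twoCharTwoCusp_of_not_dvd (hψ1 : ψ ≠ 1) {γ : SL(2, ℤ)}
    (h : ¬ (v : ℤ) ∣ γ 1 0) : (twoCharTwoConst u φ)⁻¹ * twoCharTwoCusp ψ φ γ = 0 := by
  rw [twoCharTwoCusp_of_not_dvd ψ φ hψ1 h, mul_zero]

/-- **Normalised constant terms, `c = vc'`**: `e₂ ψ(-c') φ(d)`.
[cite: DiamondShurman2005, Thm. 4.6.2] [cite: Apostol1976, Thm. 12.19] -/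
theorem inv_twoCharTwoConst_mul_twoCharTwoCusp_of_eq_mul (hψ : ψ.IsPrimitive) (hψ1 : ψ ≠ 1)
    (hφ : φ.IsPrimitive) (huv : u.Coprime v) (hpar : ψ (-1) * φ (-1) = 1) {γ : SL(2, ℤ)}
    (c' : ℤ) (hc : (γ 1 0 : ℤ) = v * c') :
    (twoCharTwoConst u φ)⁻¹ * twoCharTwoCusp ψ φ γ =
      twoCharTwoUnit ψ φ * ψ ((-c' : ℤ) : ZMod u) * φ ((γ 1 1 : ℤ) : ZMod v) := by
  haveI : NeZero (u * v) := ⟨mul_ne_zero (NeZero.ne u) (NeZero.ne v)⟩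
  have hΛp : (changeLevel (dvd_mul_right u v) ψ * changeLevel (dvd_mul_left v u) φ⁻¹).IsPrimitive :=
    isPrimitive_changeLevel_mul_changeLevel huv hψ (Literature.NumberTheory.LFunctions.isPrimitive_inv φ hφ)
  have hparΛ : (changeLevel (dvd_mul_right u v) ψ * changeLevel (dvd_mul_left v u) φ⁻¹) (-1) =
      (-1) ^ 2 := by
    rw [changeLevel_mul_changeLevel_inv_apply_neg_one, hpar]; norm_num
  have hL := LFunction_eq_bernoulli _ hΛp le_rfl hparΛ
  simp only [Nat.cast_ofNat] at hL
  have hW := gaussSum_ne_zero (changeLevel (dvd_mul_right u v) ψ * changeLevel (dvd_mul_left v u) φ⁻¹)⁻¹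
    (Literature.NumberTheory.LFunctions.isPrimitive_inv _ hΛp)
  have hWφ := gaussSum_ne_zero φ⁻¹ (Literature.NumberTheory.LFunctions.isPrimitive_inv φ hφ)
  have hu0 : (u : ℂ) ≠ 0 := by exact_mod_cast NeZero.ne u
  have hv0 : (v : ℂ) ≠ 0 := by exact_mod_cast NeZero.ne v
  have hπ : (Real.pi : ℂ) ≠ 0 := by exact_mod_cast Real.pi_ne_zero
  rw [twoCharTwoCusp_of_eq_mul ψ φ hψ1 hpar c' hc, twoCharTwoConst, twoCharTwoUnit, hL]
  simp only [Nat.factorial_two, Nat.cast_ofNat, Nat.cast_mul]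
  field_simp
  ring_nf

variable {p : ℕ} [Fact p.Prime]

/-- A value `χ(-1) = ±1` is a `p`-adic unit. [folklore] -/
theorem valuation_symm_apply_neg_one_eq_one (ι : PadicAlgCl p ≃+* ℂ) {N : ℕ} [NeZero N]
    (χ : DirichletCharacter ℂ N) : Valued.v (ι.symm (χ (-1))) = 1 := by
  have h : (χ (-1)) ^ 2 = 1 := by rw [← map_pow, neg_one_sq, map_one]
  have h2 : (Valued.v (ι.symm (χ (-1)))) ^ 2 = 1 := by
    rw [← Valuation.map_pow, ← map_pow, h, map_one, Valuation.map_one]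
  exact (pow_eq_one_iff_of_nonneg zero_le two_ne_zero).mp h2

/-- **Gauss sums of primitive characters of level prime to `p` are `p`-adic units**
(`W(χ)W(χ̄) = χ(-1) N` with both factors integral). [cite: Apostol1976, Thm. 8.11, Thm. 8.15 (c)] -/
theorem valuation_symm_gaussSum_eq_one (ι : PadicAlgCl p ≃+* ℂ) {N : ℕ} [NeZero N]
    (χ : DirichletCharacter ℂ N) (hχ : χ.IsPrimitive) (hpN : ¬ p ∣ N) :
    Valued.v (ι.symm (gaussSum χ (ZMod.stdAddChar (N := N)))) = 1 := by
  have hWW := gaussSum_mul_gaussSum_inv χ hχ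
  have hv : Valued.v (ι.symm (gaussSum χ (ZMod.stdAddChar (N := N)))) *
      Valued.v (ι.symm (gaussSum χ⁻¹ (ZMod.stdAddChar (N := N)))) = 1 := by
    rw [← Valuation.map_mul, ← map_mul, hWW, map_mul, Valuation.map_mul,
      valuation_symm_apply_neg_one_eq_one, one_mul, valuation_symm_natCast_eq_one ι hpN]
  have h1 := valuation_symm_gaussSum_le_one ι χ
  have h2 := valuation_symm_gaussSum_le_one ι χ⁻¹
  refine le_antisymm h1 ?_
  calc (1 : NNReal) = Valued.v (ι.symm (gaussSum χ (ZMod.stdAddChar (N := N)))) *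
        Valued.v (ι.symm (gaussSum χ⁻¹ (ZMod.stdAddChar (N := N)))) := hv.symm
    _ ≤ Valued.v (ι.symm (gaussSum χ (ZMod.stdAddChar (N := N)))) :=
        mul_le_of_le_one_right zero_le h2

/-- **The cusp unit `e₂` is a `p`-adic unit** when `B_{2,Λ̄}/2` is and `p ∤ 2uv` (`ψ`, `φ` primitive
with coprime conductors). [cite: DiamondShurman2005, Thm. 4.6.2] -/
theorem valuation_twoCharTwoUnit_eq_one (ι : PadicAlgCl p ≃+* ℂ) (hψ : ψ.IsPrimitive)
    (hφ : φ.IsPrimitive) (huv : u.Coprime v) (hpu : ¬ p ∣ u) (hpv : ¬ p ∣ v) (hp2 : p ≠ 2)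
    (hB : Valued.v (ι.symm (generalizedBernoulli 2
        (changeLevel (dvd_mul_right u v) ψ * changeLevel (dvd_mul_left v u) φ⁻¹)⁻¹ / 2)) = 1) :
    Valued.v (ι.symm (twoCharTwoUnit ψ φ)) = 1 := by
  haveI : NeZero (u * v) := ⟨mul_ne_zero (NeZero.ne u) (NeZero.ne v)⟩
  set Λ := changeLevel (dvd_mul_right u v) ψ * changeLevel (dvd_mul_left v u) φ⁻¹ with hΛ
  have hΛp : Λ.IsPrimitive :=
    isPrimitive_changeLevel_mul_changeLevel huv hψ (Literature.NumberTheory.LFunctions.isPrimitive_inv φ hφ)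
  have hpuv : ¬ p ∣ u * v := fun h ↦ ((Nat.Prime.dvd_mul Fact.out).mp h).elim hpu hpv
  have hWΛ := valuation_symm_gaussSum_eq_one ι Λ⁻¹
    (Literature.NumberTheory.LFunctions.isPrimitive_inv Λ hΛp) hpuv
  have hWφ := valuation_symm_gaussSum_eq_one ι φ⁻¹
    (Literature.NumberTheory.LFunctions.isPrimitive_inv φ hφ) hpv
  have hu1 : Valued.v (ι.symm (u : ℂ)) = 1 := valuation_symm_natCast_eq_one ι hpu
  have hv1 : Valued.v (ι.symm (v : ℂ)) = 1 := valuation_symm_natCast_eq_one ι hpv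
  have h2 : Valued.v (ι.symm (2 : ℂ)) = 1 := by
    have := valuation_symm_natCast_eq_one ι (n := 2)
      (fun h ↦ hp2 ((Nat.prime_dvd_prime_iff_eq Fact.out Nat.prime_two).mp h))
    exact_mod_cast this
  have hrw : twoCharTwoUnit ψ φ = -(v : ℂ) * (generalizedBernoulli 2 Λ⁻¹ / 2) /
      (2 * u * gaussSum Λ⁻¹ (ZMod.stdAddChar (N := u * v)) *
        gaussSum φ⁻¹ (ZMod.stdAddChar (N := v))) := by
    rw [twoCharTwoUnit, ← hΛ]
    ring
  have hB' : Valued.v (ι.symm (generalizedBernoulli 2 Λ⁻¹)) = 1 := by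
    rwa [map_div₀, map_div₀, h2, div_one] at hB
  rw [hrw]
  simp only [map_div₀, map_mul, map_neg, Valuation.map_neg, hv1, hB', h2, hu1, hWΛ, hWφ, mul_one,
    div_one]

/-- **`p`-integrality of the normalised coefficients**: `v((twoCharTwoConst)⁻¹ aₙ(S)) ≤ 1` for all
`n` (they are `0` and `σ_1^{ψ,φ}(n)`). [cite: DiamondShurman2005, Thm. 4.6.2] -/
theorem valuation_inv_twoCharTwoConst_mul_coeff_le_one (ι : PadicAlgCl p ≃+* ℂ) (hψ1 : ψ ≠ 1)
    (hφ : φ.IsPrimitive) (hpar : ψ (-1) * φ (-1) = 1) (n : ℕ) :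
    Valued.v (ι.symm ((twoCharTwoConst u φ)⁻¹ * (qExpansion 1 ⇑(twoCharTwoMF ψ φ)).coeff n)) ≤ 1 := by
  rw [qExpansion_coeff_twoCharTwoMF ψ φ hψ1 hφ hpar n]
  split_ifs with hn
  · rw [mul_zero, map_zero, Valuation.map_zero]; exact zero_le
  · rw [← mul_assoc, inv_mul_cancel₀ (twoCharTwoConst_ne_zero φ hφ), one_mul]
    have h := valuation_symm_divisorSum₂_le_one ι ψ φ 2 n
    simpa only [show (2 : ℕ) - 1 = 1 from rfl, pow_one] using h

end Normalised

end Literature.NumberTheory.EllipticCurves.ModularForms
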